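import Summits.FinalStateConjecture.FinalStateConjecture.Theorems.EIHFluxBalanceInertialRecessionStubCoerSymbolQuantCompact
import Summits.FinalStateConjecture.FinalStateConjecture.Theorems.EIHFluxBalanceInertialRecessionStubCoerSymbolQuantNormalise

/-!
# Route EIHFluxBalance — `InertialRecession` (E′), line `SketchCleanExcision`, skeleton r13:
# registered stub `stub_coerSymbolQuant` (C) — quantitative, uniform, robust COER-B

File for the crux `stmt-FinalStateConjecture-17403`
(`Summit.FinalStateConjecture.FinalStateConjecture.Theses.EIHFluxBalance.InertialRecession`, E′),
line `SketchCleanExcision`, skeleton r13, registered stub `stub_coerSymbolQuant` (C): the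
second/third-order slaving steps read the `C²/C³` vacuum information through the PRINCIPAL-SYMBOL
rows `Ric G'(x) − Ric G(x) = σ_{G(x)}(dx⁰)[Var x]` (`ricAt_apply_eq_add_symbol_of_jets`), and (C) is
the quantitative injectivity of `(A, d) ↦ (σ(dx⁰)[Var x_y])_y` modulo the Kerr–Schild stabiliser,
uniformly over the painted boosts `|(Λe₀)⁰| ≤ γ` and robust under an `η₀`-perturbation of the value
`G(x)`.

* `coerSym_symbol_smul`, `coerSym_core` — reduction of general data of positive reduced size to the
  normalised compactness argument `coerSym_core_normalised` (normalisation modulo the stabiliser,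
  `coerSym_normalise`; `Var` and the rows are linear in `(A, d)`);
* `stub_coerSymbolQuant` — **the registered statement**, by contradiction: if it failed for
  `c = η₀ = 1/(n+1)` on the shell `ρin = |a| + 2M + 1 ≤ ‖y‖ ≤ ρout`, the jet hypotheses turn the
  Ricci difference into the symbol rows (exactly), and `coerSym_core` applies.

No definitions, no named facts, no `sorry`.
-/

set_option linter.dupNamespace false
set_option maxSynthPendingDepth 6
set_option synthInstance.maxHeartbeats 200000

noncomputable section

namespace Summit.FinalStateConjecture.FinalStateConjecture.Theorems.SublinearIsFree.Slaving

open scoped BigOperators Topology Manifold ContDiff ENNReal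
open Filter Set Function TopologicalSpace Metric Literature.Geometry.Lorentzian
  Literature.Geometry.Lorentzian.MetricCoord
open Summit.FinalStateConjecture.FinalStateConjecture.Theorems

section Reduction

/-- The symbol rows are linear in the form slot. [folklore] -/
theorem coerSym_symbol_smul (B V : E4 →L[ℝ] E4 →L[ℝ] ℝ) (t : ℝ) (Y Z : E4) :
    (E4.dx 0 Z * E4.dx 0 (ContinuousLinearMap.inverse B (ContinuousLinearMap.flip (t • V) Y)) + E4.dx 0 Y * (t • V) (ContinuousLinearMap.inverse B (E4.dx 0)) Z - E4.dx 0 (ContinuousLinearMap.inverse B (E4.dx 0)) * (t • V) Y Z - E4.dx 0 Y * E4.dx 0 Z * MetricCoord.traceCLM E4 (ContinuousLinearMap.comp (ContinuousLinearMap.inverse B) (ContinuousLinearMap.flip (t • V)))) = t * (E4.dx 0 Z * E4.dx 0 (ContinuousLinearMap.inverse B (ContinuousLinearMap.flip V Y)) + E4.dx 0 Y * V (ContinuousLinearMap.inverse B (E4.dx 0)) Z - E4.dx 0 (ContinuousLinearMap.inverse B (E4.dx 0)) * V Y Z - E4.dx 0 Y * E4.dx 0 Z * MetricCoord.traceCLM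 E4 (ContinuousLinearMap.comp (ContinuousLinearMap.inverse B) (ContinuousLinearMap.flip V))) := by
  simp only [ContinuousLinearMap.flip_smul, ContinuousLinearMap.comp_smul, map_smul, smul_apply, smul_eq_mul]
  ring

/-- **The compactness argument, general data.** As `coerSym_core_normalised`, for skew `Aₙ`, `dₙ` of
positive reduced size `redₙ` and symbol rows `O(εₙ redₙ)`: each term is normalised modulo the
stabiliser (`coerSym_normalise`, same `Var`) and rescaled to `red = 1` (`Var` and the rows are
linear in `(A, d)`). [folklore] -/
theorem coerSym_core {M a γ ρin ρout z : ℝ} (hM : M ≠ 0) (hρ : |a| + 1 ≤ ρin)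
    (hz : 0 < z) (hza : 3 * |a| ≤ z) (hzin : (1 + 3 * γ) * ρin ≤ z) (hzout : 4 * (1 + 3 * γ) * z ≤ ρout)
    {ε : ℕ → ℝ} (hε : Tendsto ε atTop (𝓝 0))
    (Λ : ℕ → lorentzGroup) (A : ℕ → E4 →L[ℝ] E4) (d : ℕ → E4) (B : ℕ → E3 → E4 →L[ℝ] E4 →L[ℝ] ℝ)
    (hΛ : ∀ n, |((Λ n : E4 ≃L[ℝ] E4) (E4.basisVector 0)) 0| ≤ γ)
    (hA : ∀ n (u w : E4), Minkowski.bilin (A n u) w + Minkowski.bilin u (A n w) = 0)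
    (hred : ∀ n, 0 < (‖(A n) (E4.basisVector 0)‖ + ‖E4.spatial (d n)‖ + ‖a • (A n) (E4.basisVector 3)‖))
    (hB : ∀ n (y : E3), ρin ≤ ‖y‖ → ‖y‖ ≤ ρout →
      ‖B n y - boostedKerrBilin (Λ n) 0 M a (E4.ofTimeSpace 0 y)‖ ≤ ε n)
    (hσ : ∀ n (y : E3), ρin ≤ ‖y‖ → ‖y‖ ≤ ρout → ∀ Y Z : E4,
      |(E4.dx 0 Z * E4.dx 0 (ContinuousLinearMap.inverse (B n y) (ContinuousLinearMap.flip (ContinuousLinearMap.bilinearComp (fderiv ℝ (Kerr.bilin M a) ((((Λ n : E4 ≃L[ℝ] E4).symm : E4 →L[ℝ] E4)) (E4.ofTimeSpace 0 y)) ((A n) ((((Λ n : E4 ≃L[ℝ] E4).symm : E4 →L[ℝ] E4)) (E4.ofTimeSpace 0 y)) + (d n))) (((Λ n : E4 ≃L[ℝ] E4).symm : E4 →L[ℝ] E4)) (((Λ n : E4 ≃L[ℝ] E4).symm : E4 →L[ℝ] E4)) + ContinuousLinearMap.bilinearComp (Kerr.bilin M a ((((Λ n : E4 ≃L[ℝ]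 E4).symm : E4 →L[ℝ] E4)) (E4.ofTimeSpace 0 y))) (ContinuousLinearMap.comp (A n) (((Λ n : E4 ≃L[ℝ] E4).symm : E4 →L[ℝ] E4))) (((Λ n : E4 ≃L[ℝ] E4).symm : E4 →L[ℝ] E4)) + ContinuousLinearMap.bilinearComp (Kerr.bilin M a ((((Λ n : E4 ≃L[ℝ] E4).symm : E4 →L[ℝ] E4)) (E4.ofTimeSpace 0 y))) (((Λ n : E4 ≃L[ℝ] E4).symm : E4 →L[ℝ] E4)) (ContinuousLinearMap.comp (A n) (((Λ n : E4 ≃L[ℝ] E4).symm : E4 →L[ℝ] E4)))) Y)) + E4.dx 0 Y * (ContinuousLinearMap.bilinearComp (fderiv ℝ (Kerr.bilin M a) ((((Λ n : E4 ≃L[ℝ] E4).symm : E4 →L[ℝ] E4)) (E4.ofTimeSpace 0 y)) ((A n) ((((Λ n : E4 ≃L[ℝ] E4).symm : E4 →L[ℝ] E4)) (E4.ofTimeSpace 0 y)) + (d n))) (((Λ n : E4 ≃L[ℝ] E4).symm : E4 →L[ℝ] E4)) (((Λ n : E4 ≃L[ℝ] E4).symm : E4 →L[ℝ] E4)) + ContinuousLinearMap.bilinearComp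 (Kerr.bilin M a ((((Λ n : E4 ≃L[ℝ] E4).symm : E4 →L[ℝ] E4)) (E4.ofTimeSpace 0 y))) (ContinuousLinearMap.comp (A n) (((Λ n : E4 ≃L[ℝ] E4).symm : E4 →L[ℝ] E4))) (((Λ n : E4 ≃L[ℝ] E4).symm : E4 →L[ℝ] E4)) + ContinuousLinearMap.bilinearComp (Kerr.bilin M a ((((Λ n : E4 ≃L[ℝ] E4).symm : E4 →L[ℝ] E4)) (E4.ofTimeSpace 0 y))) (((Λ n : E4 ≃L[ℝ] E4).symm : E4 →L[ℝ] E4)) (ContinuousLinearMap.comp (A n) (((Λ n : E4 ≃L[ℝ] E4).symm : E4 →L[ℝ] E4)))) (ContinuousLinearMap.inverse (B n y) (E4.dx 0)) Z - E4.dx 0 (ContinuousLinearMap.inverse (B n y) (E4.dx 0)) * (ContinuousLinearMap.bilinearComp (fderiv ℝ (Kerr.bilin M a) ((((Λ n : E4 ≃L[ℝ] E4).symm : E4 →L[ℝ] E4)) (E4.ofTimeSpace 0 y)) ((A n) ((((Λ n : E4 ≃L[ℝ] E4).symm : E4 →L[ℝ] E4)) (E4.ofTimeSpace 0 y)) + (d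 n))) (((Λ n : E4 ≃L[ℝ] E4).symm : E4 →L[ℝ] E4)) (((Λ n : E4 ≃L[ℝ] E4).symm : E4 →L[ℝ] E4)) + ContinuousLinearMap.bilinearComp (Kerr.bilin M a ((((Λ n : E4 ≃L[ℝ] E4).symm : E4 →L[ℝ] E4)) (E4.ofTimeSpace 0 y))) (ContinuousLinearMap.comp (A n) (((Λ n : E4 ≃L[ℝ] E4).symm : E4 →L[ℝ] E4))) (((Λ n : E4 ≃L[ℝ] E4).symm : E4 →L[ℝ] E4)) + ContinuousLinearMap.bilinearComp (Kerr.bilin M a ((((Λ n : E4 ≃L[ℝ] E4).symm : E4 →L[ℝ] E4)) (E4.ofTimeSpace 0 y))) (((Λ n : E4 ≃L[ℝ] E4).symm : E4 →L[ℝ] E4)) (ContinuousLinearMap.comp (A n) (((Λ n : E4 ≃L[ℝ] E4).symm : E4 →L[ℝ] E4)))) Y Z - E4.dx 0 Y * E4.dx 0 Z * MetricCoord.traceCLM E4 (ContinuousLinearMap.comp (ContinuousLinearMap.inverse (B n y)) (ContinuousLinearMap.flip (ContinuousLinearMap.bilinearComp (fderiv ℝ (Kerr.bilin M a) ((((Λ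 n : E4 ≃L[ℝ] E4).symm : E4 →L[ℝ] E4)) (E4.ofTimeSpace 0 y)) ((A n) ((((Λ n : E4 ≃L[ℝ] E4).symm : E4 →L[ℝ] E4)) (E4.ofTimeSpace 0 y)) + (d n))) (((Λ n : E4 ≃L[ℝ] E4).symm : E4 →L[ℝ] E4)) (((Λ n : E4 ≃L[ℝ] E4).symm : E4 →L[ℝ] E4)) + ContinuousLinearMap.bilinearComp (Kerr.bilin M a ((((Λ n : E4 ≃L[ℝ] E4).symm : E4 →L[ℝ] E4)) (E4.ofTimeSpace 0 y))) (ContinuousLinearMap.comp (A n) (((Λ n : E4 ≃L[ℝ] E4).symm : E4 →L[ℝ] E4))) (((Λ n : E4 ≃L[ℝ] E4).symm : E4 →L[ℝ] E4)) + ContinuousLinearMap.bilinearComp (Kerr.bilin M a ((((Λ n : E4 ≃L[ℝ] E4).symm : E4 →L[ℝ] E4)) (E4.ofTimeSpace 0 y))) (((Λ n : E4 ≃L[ℝ] E4).symm : E4 →L[ℝ] E4)) (ContinuousLinearMap.comp (A n) (((Λ n : E4 ≃L[ℝ] E4).symm : E4 →L[ℝ] E4)))))))| ≤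
        ε n * (‖(A n) (E4.basisVector 0)‖ + ‖E4.spatial (d n)‖ + ‖a • (A n) (E4.basisVector 3)‖) * ‖Y‖ * ‖Z‖) :
    False := by
  -- normalise and rescale each term
  have key : ∀ n, ∃ (A' : E4 →L[ℝ] E4) (d' : E4),
      (∀ u w : E4, Minkowski.bilin (A' u) w + Minkowski.bilin u (A' w) = 0) ∧
      ‖A'‖ ≤ 3 + 3 * |a|⁻¹ ∧ ‖d'‖ ≤ 3 + 3 * |a|⁻¹ ∧ (‖A' (E4.basisVector 0)‖ + ‖E4.spatial d'‖ + ‖a • A' (E4.basisVector 3)‖) = 1 ∧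
      ∀ y : E3, ρin ≤ ‖y‖ → (ContinuousLinearMap.bilinearComp (fderiv ℝ (Kerr.bilin M a) ((((Λ n : E4 ≃L[ℝ] E4).symm : E4 →L[ℝ] E4)) (E4.ofTimeSpace 0 y)) (A' ((((Λ n : E4 ≃L[ℝ] E4).symm : E4 →L[ℝ] E4)) (E4.ofTimeSpace 0 y)) + d')) (((Λ n : E4 ≃L[ℝ] E4).symm : E4 →L[ℝ] E4)) (((Λ n : E4 ≃L[ℝ] E4).symm : E4 →L[ℝ] E4)) + ContinuousLinearMap.bilinearComp (Kerr.bilin M a ((((Λ n : E4 ≃L[ℝ] E4).symm : E4 →L[ℝ] E4)) (E4.ofTimeSpace 0 y))) (ContinuousLinearMap.comp A' (((Λ n : E4 ≃L[ℝ] E4).symm : E4 →L[ℝ] E4))) (((Λ n : E4 ≃L[ℝ] E4).symm : E4 →L[ℝ] E4)) + ContinuousLinearMap.bilinearComp (Kerr.bilin M a ((((Λ n : E4 ≃L[ℝ] E4).symm : E4 →L[ℝ] E4)) (E4.ofTimeSpace 0 y))) (((Λ n : E4 ≃L[ℝ] E4).symm : E4 →L[ℝ] E4)) (ContinuousLinearMap.comp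 A' (((Λ n : E4 ≃L[ℝ] E4).symm : E4 →L[ℝ] E4)))) =
        ((‖(A n) (E4.basisVector 0)‖ + ‖E4.spatial (d n)‖ + ‖a • (A n) (E4.basisVector 3)‖))⁻¹ • (ContinuousLinearMap.bilinearComp (fderiv ℝ (Kerr.bilin M a) ((((Λ n : E4 ≃L[ℝ] E4).symm : E4 →L[ℝ] E4)) (E4.ofTimeSpace 0 y)) ((A n) ((((Λ n : E4 ≃L[ℝ] E4).symm : E4 →L[ℝ] E4)) (E4.ofTimeSpace 0 y)) + (d n))) (((Λ n : E4 ≃L[ℝ] E4).symm : E4 →L[ℝ] E4)) (((Λ n : E4 ≃L[ℝ] E4).symm : E4 →L[ℝ] E4)) + ContinuousLinearMap.bilinearComp (Kerr.bilin M a ((((Λ n : E4 ≃L[ℝ] E4).symm : E4 →L[ℝ] E4)) (E4.ofTimeSpace 0 y))) (ContinuousLinearMap.comp (A n) (((Λ n : E4 ≃L[ℝ] E4).symm : E4 →L[ℝ] E4))) (((Λ n : E4 ≃L[ℝ] E4).symm : E4 →L[ℝ] E4)) + ContinuousLinearMap.bilinearComp (Kerr.bilin M a ((((Λ n : E4 ≃L[ℝ]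 E4).symm : E4 →L[ℝ] E4)) (E4.ofTimeSpace 0 y))) (((Λ n : E4 ≃L[ℝ] E4).symm : E4 →L[ℝ] E4)) (ContinuousLinearMap.comp (A n) (((Λ n : E4 ≃L[ℝ] E4).symm : E4 →L[ℝ] E4)))) := by
    intro n
    obtain ⟨A', d', hA', hlie, he0, hsd, he3, hnA, hnd⟩ := coerSym_normalise M a (hA n) (d n)
    have hr0 := hred n
    have hi0 : 0 < ((‖(A n) (E4.basisVector 0)‖ + ‖E4.spatial (d n)‖ + ‖a • (A n) (E4.basisVector 3)‖))⁻¹ := inv_pos.2 hr0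
    have ha0 : 0 ≤ 3 * |a|⁻¹ := by positivity
    refine ⟨((‖(A n) (E4.basisVector 0)‖ + ‖E4.spatial (d n)‖ + ‖a • (A n) (E4.basisVector 3)‖))⁻¹ • A', ((‖(A n) (E4.basisVector 0)‖ + ‖E4.spatial (d n)‖ + ‖a • (A n) (E4.basisVector 3)‖))⁻¹ • d', fun u w ↦ coerSym_skew_smul hA' _ u w,
      ?_, ?_, ?_, fun y hy ↦ ?_⟩
    · rw [norm_smul, Real.norm_eq_abs, abs_of_pos hi0]
      calc ((‖(A n) (E4.basisVector 0)‖ + ‖E4.spatial (d n)‖ + ‖a • (A n) (E4.basisVector 3)‖))⁻¹ * ‖A'‖ ≤ ((‖(A n) (E4.basisVector 0)‖ + ‖E4.spatial (d n)‖ + ‖a • (A n) (E4.basisVector 3)‖))⁻¹ * ((3 + 3 * |a|⁻¹) * (‖(A n) (E4.basisVector 0)‖ + ‖E4.spatial (d n)‖ + ‖a • (A n) (E4.basisVector 3)‖)) :=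
            mul_le_mul_of_nonneg_left hnA hi0.le
        _ = 3 + 3 * |a|⁻¹ := by field_simp
    · rw [norm_smul, Real.norm_eq_abs, abs_of_pos hi0]
      calc ((‖(A n) (E4.basisVector 0)‖ + ‖E4.spatial (d n)‖ + ‖a • (A n) (E4.basisVector 3)‖))⁻¹ * ‖d'‖ ≤ ((‖(A n) (E4.basisVector 0)‖ + ‖E4.spatial (d n)‖ + ‖a • (A n) (E4.basisVector 3)‖))⁻¹ * (‖(A n) (E4.basisVector 0)‖ + ‖E4.spatial (d n)‖ + ‖a • (A n) (E4.basisVector 3)‖) :=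
            mul_le_mul_of_nonneg_left hnd hi0.le
        _ = 1 := inv_mul_cancel₀ hr0.ne'
        _ ≤ 3 + 3 * |a|⁻¹ := by linarith
    · rw [coerSym_red_smul, he0, hsd, he3, abs_of_pos hi0, inv_mul_cancel₀ hr0.ne']
    · have hrad : 0 < Kerr.radius a ((((Λ n : E4 ≃L[ℝ] E4).symm : E4 →L[ℝ] E4)) (E4.ofTimeSpace 0 y)) :=
        lt_of_lt_of_le one_pos (coerSym_le_radius_symm (Λ n) a zero_le_one (y := y) (by linarith)).1
      ext v w
      have h1 := coerSym_lieForm_smul M a ((((Λ n : E4 ≃L[ℝ] E4).symm : E4 →L[ℝ] E4)) (E4.ofTimeSpace 0 y))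
        A' d' ((‖(A n) (E4.basisVector 0)‖ + ‖E4.spatial (d n)‖ + ‖a • (A n) (E4.basisVector 3)‖))⁻¹ ((((Λ n : E4 ≃L[ℝ] E4).symm : E4 →L[ℝ] E4)) v)
        ((((Λ n : E4 ≃L[ℝ] E4).symm : E4 →L[ℝ] E4)) w)
      have h2 := hlie _ hrad ((((Λ n : E4 ≃L[ℝ] E4).symm : E4 →L[ℝ] E4)) v)
        ((((Λ n : E4 ≃L[ℝ] E4).symm : E4 →L[ℝ] E4)) w)
      simp only [add_apply, ContinuousLinearMap.bilinearComp_apply, ContinuousLinearMap.comp_apply,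
        FunLike.coe_smul, Pi.smul_apply, smul_eq_mul] at h1 ⊢
      linear_combination h1 + ((‖(A n) (E4.basisVector 0)‖ + ‖E4.spatial (d n)‖ + ‖a • (A n) (E4.basisVector 3)‖))⁻¹ * h2
  choose A' d' hA' hAC hdC hred1 hvar using key
  refine coerSym_core_normalised (C := 3 + 3 * |a|⁻¹) hM hρ hz hza hzin hzout hε Λ A' d' B hΛ hA' hAC hdC
    hred1 hB fun n y hy1 hy2 Y Z ↦ ?_
  have hr0 := hred n
  rw [hvar n y hy1, coerSym_symbol_smul, abs_mul, abs_inv, abs_of_pos hr0]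
  calc ((‖(A n) (E4.basisVector 0)‖ + ‖E4.spatial (d n)‖ + ‖a • (A n) (E4.basisVector 3)‖))⁻¹ * |(E4.dx 0 Z * E4.dx 0 (ContinuousLinearMap.inverse (B n y) (ContinuousLinearMap.flip (ContinuousLinearMap.bilinearComp (fderiv ℝ (Kerr.bilin M a) ((((Λ n : E4 ≃L[ℝ] E4).symm : E4 →L[ℝ] E4)) (E4.ofTimeSpace 0 y)) ((A n) ((((Λ n : E4 ≃L[ℝ] E4).symm : E4 →L[ℝ] E4)) (E4.ofTimeSpace 0 y)) + (d n))) (((Λ n : E4 ≃L[ℝ] E4).symm : E4 →L[ℝ] E4)) (((Λ n : E4 ≃L[ℝ] E4).symm : E4 →L[ℝ] E4)) + ContinuousLinearMap.bilinearComp (Kerr.bilin M a ((((Λ n : E4 ≃L[ℝ] E4).symm : E4 →L[ℝ] E4)) (E4.ofTimeSpace 0 y))) (ContinuousLinearMap.comp (A n) (((Λ n : E4 ≃L[ℝ] E4).symm : E4 →L[ℝ] E4))) (((Λ n : E4 ≃L[ℝ] E4).symm : E4 →L[ℝ] E4)) + ContinuousLinearMap.bilinearComp (Kerr.bilin M a ((((Λ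 n : E4 ≃L[ℝ] E4).symm : E4 →L[ℝ] E4)) (E4.ofTimeSpace 0 y))) (((Λ n : E4 ≃L[ℝ] E4).symm : E4 →L[ℝ] E4)) (ContinuousLinearMap.comp (A n) (((Λ n : E4 ≃L[ℝ] E4).symm : E4 →L[ℝ] E4)))) Y)) + E4.dx 0 Y * (ContinuousLinearMap.bilinearComp (fderiv ℝ (Kerr.bilin M a) ((((Λ n : E4 ≃L[ℝ] E4).symm : E4 →L[ℝ] E4)) (E4.ofTimeSpace 0 y)) ((A n) ((((Λ n : E4 ≃L[ℝ] E4).symm : E4 →L[ℝ] E4)) (E4.ofTimeSpace 0 y)) + (d n))) (((Λ n : E4 ≃L[ℝ] E4).symm : E4 →L[ℝ] E4)) (((Λ n : E4 ≃L[ℝ] E4).symm : E4 →L[ℝ] E4)) + ContinuousLinearMap.bilinearComp (Kerr.bilin M a ((((Λ n : E4 ≃L[ℝ] E4).symm : E4 →L[ℝ] E4)) (E4.ofTimeSpace 0 y))) (ContinuousLinearMap.comp (A n) (((Λ n : E4 ≃L[ℝ] E4).symm : E4 →L[ℝ] E4))) (((Λ n : E4 ≃L[ℝ] E4).symm : E4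 →L[ℝ] E4)) + ContinuousLinearMap.bilinearComp (Kerr.bilin M a ((((Λ n : E4 ≃L[ℝ] E4).symm : E4 →L[ℝ] E4)) (E4.ofTimeSpace 0 y))) (((Λ n : E4 ≃L[ℝ] E4).symm : E4 →L[ℝ] E4)) (ContinuousLinearMap.comp (A n) (((Λ n : E4 ≃L[ℝ] E4).symm : E4 →L[ℝ] E4)))) (ContinuousLinearMap.inverse (B n y) (E4.dx 0)) Z - E4.dx 0 (ContinuousLinearMap.inverse (B n y) (E4.dx 0)) * (ContinuousLinearMap.bilinearComp (fderiv ℝ (Kerr.bilin M a) ((((Λ n : E4 ≃L[ℝ] E4).symm : E4 →L[ℝ] E4)) (E4.ofTimeSpace 0 y)) ((A n) ((((Λ n : E4 ≃L[ℝ] E4).symm : E4 →L[ℝ] E4)) (E4.ofTimeSpace 0 y)) + (d n))) (((Λ n : E4 ≃L[ℝ] E4).symm : E4 →L[ℝ] E4)) (((Λ n : E4 ≃L[ℝ] E4).symm : E4 →L[ℝ] E4)) + ContinuousLinearMap.bilinearComp (Kerr.bilin M a ((((Λ n : E4 ≃L[ℝ] E4).symm : E4 →L[ℝ] E4)) (E4.ofTimeSpace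 0 y))) (ContinuousLinearMap.comp (A n) (((Λ n : E4 ≃L[ℝ] E4).symm : E4 →L[ℝ] E4))) (((Λ n : E4 ≃L[ℝ] E4).symm : E4 →L[ℝ] E4)) + ContinuousLinearMap.bilinearComp (Kerr.bilin M a ((((Λ n : E4 ≃L[ℝ] E4).symm : E4 →L[ℝ] E4)) (E4.ofTimeSpace 0 y))) (((Λ n : E4 ≃L[ℝ] E4).symm : E4 →L[ℝ] E4)) (ContinuousLinearMap.comp (A n) (((Λ n : E4 ≃L[ℝ] E4).symm : E4 →L[ℝ] E4)))) Y Z - E4.dx 0 Y * E4.dx 0 Z * MetricCoord.traceCLM E4 (ContinuousLinearMap.comp (ContinuousLinearMap.inverse (B n y)) (ContinuousLinearMap.flip (ContinuousLinearMap.bilinearComp (fderiv ℝ (Kerr.bilin M a) ((((Λ n : E4 ≃L[ℝ] E4).symm : E4 →L[ℝ] E4)) (E4.ofTimeSpace 0 y)) ((A n) ((((Λ n : E4 ≃L[ℝ] E4).symm : E4 →L[ℝ] E4)) (E4.ofTimeSpace 0 y)) + (d n))) (((Λ n : E4 ≃L[ℝ] E4).symm : E4 →L[ℝ] E4)) (((Λ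 n : E4 ≃L[ℝ] E4).symm : E4 →L[ℝ] E4)) + ContinuousLinearMap.bilinearComp (Kerr.bilin M a ((((Λ n : E4 ≃L[ℝ] E4).symm : E4 →L[ℝ] E4)) (E4.ofTimeSpace 0 y))) (ContinuousLinearMap.comp (A n) (((Λ n : E4 ≃L[ℝ] E4).symm : E4 →L[ℝ] E4))) (((Λ n : E4 ≃L[ℝ] E4).symm : E4 →L[ℝ] E4)) + ContinuousLinearMap.bilinearComp (Kerr.bilin M a ((((Λ n : E4 ≃L[ℝ] E4).symm : E4 →L[ℝ] E4)) (E4.ofTimeSpace 0 y))) (((Λ n : E4 ≃L[ℝ] E4).symm : E4 →L[ℝ] E4)) (ContinuousLinearMap.comp (A n) (((Λ n : E4 ≃L[ℝ] E4).symm : E4 →L[ℝ] E4)))))))|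
        ≤ ((‖(A n) (E4.basisVector 0)‖ + ‖E4.spatial (d n)‖ + ‖a • (A n) (E4.basisVector 3)‖))⁻¹ * (ε n * (‖(A n) (E4.basisVector 0)‖ + ‖E4.spatial (d n)‖ + ‖a • (A n) (E4.basisVector 3)‖) * ‖Y‖ * ‖Z‖) :=
          mul_le_mul_of_nonneg_left (hσ n y hy1 hy2 Y Z) (inv_pos.2 hr0).le
    _ = ε n * ‖Y‖ * ‖Z‖ := by field_simp

end Reduction

/-! ### The registered statement -/

set_option maxHeartbeats 400000 in
/-- **Registered stub `stub_coerSymbolQuant` (C) of skeleton r13: quantitative, uniform, robust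
COER-B.** For `|a| < M`, `1 ≤ γ` there are `c, η₀ > 0` and a lab shell `ρin ≤ ‖y‖ ≤ ρout` (painted
radius `> 2M` there for every boost with Lorentz factor `≤ γ`) such that: for every painted frame
`Λ` (`|(Λe₀)⁰| ≤ γ`), every infinitesimal rest-frame Poincaré motion `(A, d)` (`A` `η`-skew), and
every pair of metric components `G, G'` on an open set containing the shell events `x = (0, y)` with
`‖G(x) − K_Λ(x)‖ ≤ η₀`, equal `1`-jets and `D²G'(x) = D²G(x) + dx⁰ ⊗ dx⁰ ⊗ Var(x)` (`Var` the lab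
first-variation form of the painted summand `K_Λ = boostedKerrBilin Λ 0 M a`), some shell event has
`c (‖Ae₀‖ + ‖d⃗‖ + ‖a Ae₃‖) ≤ ‖Ric G'(x) − Ric G(x)‖`. Proof: `Ric G' − Ric G = σ_{G(x)}(dx⁰)[Var x]`
exactly (`ricAt_apply_eq_add_symbol_of_jets`); if the statement failed for `c = η₀ = 1/(n+1)` the
compactness argument `coerSym_core` (normalisation modulo the stabiliser, convergent subsequence of
`(Λₙ⁻¹, Aₙ, dₙ)`, continuity of the rows, kernel at the three lab axis events, `axisKernel_slab`)
gives a contradiction. [folklore] -/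
theorem stub_coerSymbolQuant :
    ∀ (M a γ : ℝ), |a| < M → 1 ≤ γ → (∃ c ρin ρout η₀ : ℝ, 0 < c ∧ 0 < η₀ ∧ 0 < ρin ∧ ρin ≤ ρout ∧ (∀ (L : lorentzGroup) (y : E3), |((L : E4 ≃L[ℝ] E4) (E4.basisVector 0)) 0| ≤ γ → ρin ≤ ‖y‖ → 2 * M < Kerr.radius a (poincareInv L 0 (E4.ofTimeSpace 0 y))) ∧ ∀ (L : lorentzGroup) (A : E4 →L[ℝ] E4) (d : E4) (G G' : E4 → E4 →L[ℝ] E4 →L[ℝ] ℝ) (V : Set E4), |((L : E4 ≃L[ℝ] E4) (E4.basisVector 0)) 0| ≤ γ → (∀ u w : E4, Minkowski.bilin (A u) w + Minkowski.bilin u (A w) = 0) → MetricCoord.IsMetricOn G V → MetricCoord.IsMetricOn G' V → (∀ y : E3, ρin ≤ ‖y‖ → ‖y‖ ≤ ρout → (E4.ofTimeSpace 0 y) ∈ V ∧ ‖G (E4.ofTimeSpace 0 y) - boostedKerrBilin L 0 M a (E4.ofTimeSpace 0 y)‖ ≤ η₀ ∧ G' (E4.ofTimeSpace 0 y) = G (E4.ofTimeSpace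 0 y) ∧ fderiv ℝ G' (E4.ofTimeSpace 0 y) = fderiv ℝ G (E4.ofTimeSpace 0 y) ∧ ∀ v : E4, fderiv ℝ (fderiv ℝ G') (E4.ofTimeSpace 0 y) v = fderiv ℝ (fderiv ℝ G) (E4.ofTimeSpace 0 y) v + (v 0) • (E4.dx 0).smulRight ((fderiv ℝ (Kerr.bilin M a) (poincareInv L 0 (E4.ofTimeSpace 0 y)) (A (poincareInv L 0 (E4.ofTimeSpace 0 y)) + d)).bilinearComp (((L : E4 ≃L[ℝ] E4).symm : E4 →L[ℝ] E4)) (((L : E4 ≃L[ℝ] E4).symm : E4 →L[ℝ] E4)) + (Kerr.bilin M a (poincareInv L 0 (E4.ofTimeSpace 0 y))).bilinearComp (A.comp (((L : E4 ≃L[ℝ] E4).symm : E4 →L[ℝ] E4))) (((L : E4 ≃L[ℝ] E4).symm : E4 →L[ℝ] E4)) + (Kerr.bilin M a (poincareInv L 0 (E4.ofTimeSpace 0 y))).bilinearComp (((L : E4 ≃L[ℝ] E4).symm : E4 →L[ℝ] E4)) (A.comp (((L : E4 ≃L[ℝ] E4).symm : E4 →L[ℝ] E4))))) → ∃ y : E3,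 ρin ≤ ‖y‖ ∧ ‖y‖ ≤ ρout ∧ c * (‖A (E4.basisVector 0)‖ + ‖E4.spatial d‖ + ‖a • A (E4.basisVector 3)‖) ≤ ‖MetricCoord.ricAt G' (E4.ofTimeSpace 0 y) - MetricCoord.ricAt G (E4.ofTimeSpace 0 y)‖) := by
  intro M a γ haM hγ
  have hM : 0 < M := lt_of_le_of_lt (abs_nonneg a) haM
  have hγ0 : 0 ≤ γ := by linarith
  -- the shell
  obtain ⟨ρin, hρin⟩ : ∃ ρin : ℝ, ρin = |a| + 2 * M + 1 := ⟨_, rfl⟩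
  obtain ⟨z, hz⟩ : ∃ z : ℝ, z = 3 * |a| + (1 + 3 * γ) * ρin := ⟨_, rfl⟩
  obtain ⟨ρout, hρout⟩ : ∃ ρout : ℝ, ρout = 4 * (1 + 3 * γ) * z := ⟨_, rfl⟩
  have hρin0 : 0 < ρin := by rw [hρin]; positivity
  have h13 : 1 ≤ 1 + 3 * γ := by linarith
  have hzin : (1 + 3 * γ) * ρin ≤ z := by rw [hz]; linarith [abs_nonneg a]
  have hzpos : 0 < z := lt_of_lt_of_le (by positivity) hzin
  have hza : 3 * |a| ≤ z := by rw [hz]; nlinarith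
  have hzout : 4 * (1 + 3 * γ) * z ≤ ρout := by rw [hρout]
  have hinout : ρin ≤ ρout := by nlinarith
  have hρ1 : |a| + 1 ≤ ρin := by rw [hρin]; linarith
  have RAD : ∀ (L : lorentzGroup) (y : E3), |((L : E4 ≃L[ℝ] E4) (E4.basisVector 0)) 0| ≤ γ → ρin ≤ ‖y‖ →
      2 * M < Kerr.radius a (poincareInv L 0 (E4.ofTimeSpace 0 y)) := fun L y _ hy ↦ by
    have h := (coerSym_le_radius_symm L a (L := 2 * M + 1) (by positivity) (y := y)
      (by rw [hρin] at hy; linarith)).2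
    linarith
  by_contra H
  push Not at H
  have H' := fun n : ℕ ↦ H (1 / ((n : ℝ) + 1)) ρin ρout (1 / ((n : ℝ) + 1)) (by positivity) (by positivity)
    hρin0 hinout RAD
  choose L A d G G' V hL hA hG hG' hJ hlt using H'
  have hε : Tendsto (fun n : ℕ ↦ (2 : ℝ) / ((n : ℝ) + 1)) atTop (𝓝 0) := by
    simpa only [mul_one_div, mul_zero] using (tendsto_one_div_add_atTop_nhds_zero_nat).const_mul (2 : ℝ)
  refine coerSym_core (ε := fun n : ℕ ↦ (2 : ℝ) / ((n : ℝ) + 1)) hM.ne' hρ1 hzpos hza hzin hzout hε L A d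
    (fun n y ↦ G n (E4.ofTimeSpace 0 y)) hL hA (fun n ↦ ?_) (fun n y hy1 hy2 ↦ ?_) (fun n y hy1 hy2 Y Z ↦ ?_)
  · -- the reduced size is positive (the strict inequality on the nonempty shell)
    obtain ⟨y₀, hy₀⟩ := exists_norm_eq E3 hρin0.le
    have h := hlt n y₀ hy₀.ge (hy₀.le.trans hinout)
    have h0 := norm_nonneg (MetricCoord.ricAt (G' n) (E4.ofTimeSpace 0 y₀) - MetricCoord.ricAt (G n) (E4.ofTimeSpace 0 y₀))
    by_contra hneg
    push Not at hneg
    have h1 : 1 / ((n : ℝ) + 1) * (‖A n (E4.basisVector 0)‖ + ‖E4.spatial (d n)‖ + ‖a • A n (E4.basisVector 3)‖) ≤ 0 :=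
      mul_nonpos_of_nonneg_of_nonpos (by positivity) hneg
    linarith
  · exact (hJ n y hy1 hy2).2.1.trans (by gcongr; norm_num)
  · obtain ⟨hxV, -, h0, h1, h2⟩ := hJ n y hy1 hy2
    have key := ricAt_apply_eq_add_symbol_of_jets (hG n) (hG' n) hxV h0 h1 (ζ := E4.dx 0)
      (fun v ↦ by rw [h2 v]; rfl) Y Z
    rw [mtrAt_eq_traceCLM, show sharpAt (G n) (E4.ofTimeSpace 0 y) = (G n (E4.ofTimeSpace 0 y)).inverse from rfl,
      coerSym_poincareInv_zero] at key
    have hb : |MetricCoord.ricAt (G' n) (E4.ofTimeSpace 0 y) Y Z - MetricCoord.ricAt (G n) (E4.ofTimeSpace 0 y) Y Z| ≤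
        ‖MetricCoord.ricAt (G' n) (E4.ofTimeSpace 0 y) - MetricCoord.ricAt (G n) (E4.ofTimeSpace 0 y)‖ * ‖Y‖ * ‖Z‖ := by
      rw [← Real.norm_eq_abs, ← sub_apply, ← sub_apply]
      exact ContinuousLinearMap.le_opNorm₂ _ Y Z
    have hl := mul_le_mul_of_nonneg_right (mul_le_mul_of_nonneg_right (hlt n y hy1 hy2).le (norm_nonneg Y))
      (norm_nonneg Z)
    rw [show (2 : ℝ) / ((n : ℝ) + 1) = 2 * (1 / ((n : ℝ) + 1)) by ring]
    calc |_| = 2 * |MetricCoord.ricAt (G' n) (E4.ofTimeSpace 0 y) Y Z -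
          MetricCoord.ricAt (G n) (E4.ofTimeSpace 0 y) Y Z| := by
            rw [← abs_two, ← abs_mul]; congr 1; linear_combination (-2 : ℝ) * key
      _ ≤ 2 * (‖MetricCoord.ricAt (G' n) (E4.ofTimeSpace 0 y) - MetricCoord.ricAt (G n) (E4.ofTimeSpace 0 y)‖ *
          ‖Y‖ * ‖Z‖) := by linarith
      _ ≤ 2 * (1 / ((n : ℝ) + 1) * (‖A n (E4.basisVector 0)‖ + ‖E4.spatial (d n)‖ + ‖a • A n (E4.basisVector 3)‖) *
          ‖Y‖ * ‖Z‖) := by linarith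
      _ = 2 * (1 / ((n : ℝ) + 1)) * (‖A n (E4.basisVector 0)‖ + ‖E4.spatial (d n)‖ + ‖a • A n (E4.basisVector 3)‖) *
          ‖Y‖ * ‖Z‖ := by ring

end Summit.FinalStateConjecture.FinalStateConjecture.Theorems.SublinearIsFree.Slaving

end
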